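import Literature.Geometry.Kaehler.AtlasCocycle
import Literature.Geometry.Kaehler.ApproxHermitianYangMills
import Literature.Geometry.Kaehler.PluriharmonicLog
import HarnessLib

/-!
# A smooth unitary connection in atlas frames is a connection on the transition cocycle

Layer `Literature/Geometry/Kaehler`. Bridge between the two renderings of connections in the tree:

* `UnitaryConnection E F h` (`ApproxHermitianYangMills.lean`): for a Mathlib complex vector bundle `V`
  with Hermitian structure `h`, the `End F`-valued connection `1`-forms `θ_{x₀}` in the frames of the
  atlas, with the gauge law `θ_{x₀} = a⁻¹ θ_{x₁} a + a⁻¹ da`, `a = atlasTransition V x₀ x₁`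
  (Kobayashi I (1.16)) and unitarity (4.6)′;
* `SmoothComplexVectorBundle.Connection` (`ComplexVectorBundle.lean`) on the transition cocycle
  `SmoothComplexVectorBundle.ofVectorBundle F V b hV` (`AtlasCocycle.lean`): MATRICES of `1`-forms
  `ω_{x₀} = [θ_{x₀}]_b` in a basis `b` of the model fibre, gauge law `ω_j = g_{ji} ω_i g_{ij} + g_{ji} dg_{ij}`
  with `g_{x₀x₁} = [atlasTransition V x₁ x₀]_b`.

`UnitaryConnection.toCocycleConnection b hV D` reads the matrices of `D` in `b`; the gauge laws
correspond EXACTLY (`[A ∘ B] = [A][B]`, and `d` commutes with taking a matrix entry,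
`mextDeriv_ofFun_clm_apply`), so the Chern–Weil Chern character forms
`ch_k(E, D) = (1/k!) tr((−Ω/2πi)ᵏ)` of `ComplexVectorBundle.lean` and the Chern character of
`ChernCharacter.lean` are available for every smooth unitary connection of the analytic side (the
approximately Hermitian–Yang–Mills connections of route `HodgeConjecture/HolomorphicDefect`).
Unitarity is not used (any connection computes `ch_k`, Kobayashi II (2.10)).

## References

* [Kobayashi1987] S. Kobayashi, Differential Geometry of Complex Vector Bundles (1987), Ch. I §1
  (1.2), (1.6)–(1.7), (1.15)–(1.16).
-/

noncomputable section

open scoped Manifold ContDiff Topology Matrix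
open Set Bundle Module

namespace Literature.Geometry.Kaehler

/-! ### Post-composition of forms with a continuous linear map of the coefficients -/

section PostComp

variable {E : Type*} [NormedAddCommGroup E] [NormedSpace ℝ E]
  {H : Type*} [TopologicalSpace H] {I : ModelWithCorners ℝ E H}
  {M : Type*} [TopologicalSpace M] [ChartedSpace H M]
  {F : Type*} [NormedAddCommGroup F] [NormedSpace ℝ F]
  {F' : Type*} [NormedAddCommGroup F'] [NormedSpace ℝ F'] {k : ℕ}

/-- **Post-composition** of an `F`-valued form with a continuous linear map `φ : F → F'` of the
coefficients: `(φ ∘ α)(v) = φ(α(v))` (e.g. a matrix entry of an `End`-valued form). [folklore] -/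
def MForm.postcomp (α : MForm I M F k) (φ : F →L[ℝ] F') : MForm I M F' k := fun x ↦
  φ.compContinuousAlternatingMap (α x)

/-- Evaluation of `φ ∘ α` (definitional). [folklore] -/
@[simp]
theorem MForm.postcomp_apply (α : MForm I M F k) (φ : F →L[ℝ] F') (x : M) (v : Fin k → TangentSpace I x) :
    α.postcomp φ x v = φ (α x v) :=
  rfl

/-- The chart representative of `φ ∘ α` is `φ ∘ (α^chart)`. [folklore] -/
theorem MForm.inChart_postcomp (α : MForm I M F k) (φ : F →L[ℝ] F') (x₀ : M) :
    (α.postcomp φ).inChart x₀ = fun y ↦ φ.compContinuousAlternatingMap (α.inChart x₀ y) := by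
  funext y
  ext v
  rfl

/-- `φ ∘ α` is smooth at `x` if `α` is (post-composition is a continuous linear map of the values,
commuting with every chart). [folklore] -/
theorem MForm.SmoothAt.postcomp {α : MForm I M F k} {x : M} (hα : α.SmoothAt x) (φ : F →L[ℝ] F') :
    (α.postcomp φ).SmoothAt x := by
  rw [MForm.SmoothAt, MForm.inChart_postcomp]
  exact ((ContinuousLinearMap.compContinuousAlternatingMapCLM ℝ E F F' (Fin k) φ).contDiff.of_le
    le_top).comp_contDiffWithinAt hα

/-- `φ ∘ α` is smooth on `U` if `α` is. [folklore] -/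
theorem IsSmoothFormOn.postcomp {α : MForm I M F k} {U : Set M} (hα : IsSmoothFormOn α U)
    (φ : F →L[ℝ] F') : IsSmoothFormOn (α.postcomp φ) U := fun x hx ↦
  MForm.SmoothAt.postcomp (hα x hx) φ

variable [IsManifold I ∞ M]

/-- **`d` commutes with a continuous linear map of the values of a function**: for `f : M → F` smooth
at `x` (manifold sense), `d(φ ∘ f)(x) v = φ(df(x) v)` (chain rule in the chart at `x`). [folklore] -/
theorem mextDeriv_ofFun_clm_apply {f : M → F} {x : M} (hf : ContMDiffAt I 𝓘(ℝ, F) ∞ f x)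
    (φ : F →L[ℝ] F') (v : Fin 1 → TangentSpace I x) :
    mextDeriv (MForm.ofFun I fun y ↦ φ (f y)) x v = φ (mextDeriv (MForm.ofFun I f) x v) := by
  have hU : UniqueDiffWithinAt ℝ (range I) (extChartAt I x x) :=
    I.uniqueDiffOn _ (mem_range_self _)
  have h1 : ContDiffWithinAt ℝ ∞ (f ∘ (extChartAt I x).symm) (range I) (extChartAt I x x) := by
    simpa using (contMDiffAt_iff.1 hf).2
  have hd : DifferentiableWithinAt ℝ (f ∘ (extChartAt I x).symm) (range I) (extChartAt I x x) :=
    h1.differentiableWithinAt (by simp)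
  have hcomp : ((fun y ↦ φ (f y)) ∘ (extChartAt I x).symm) = φ ∘ (f ∘ (extChartAt I x).symm) := rfl
  rw [mextDeriv_ofFun_apply, mextDeriv_ofFun_apply, hcomp,
    (φ.hasFDerivAt.comp_hasFDerivWithinAt _ hd.hasFDerivWithinAt).fderivWithin hU]
  rfl

end PostComp

/-! ### Matrix entries of operators -/

section Entry

variable {F : Type*} [NormedAddCommGroup F] [NormedSpace ℂ F] [FiniteDimensional ℂ F] {r : ℕ}

/-- The `(a, c)` matrix entry in the basis `b`, as a real-continuous linear functional on `End F`:
`L ↦ [L]_{ac} = b^*_a (L b_c)`. [folklore] -/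
def entryCLM (b : Module.Basis (Fin r) ℂ F) (a c : Fin r) : (F →L[ℂ] F) →L[ℝ] ℂ :=
  ((LinearMap.toContinuousLinearMap (b.coord a)).comp (ContinuousLinearMap.apply ℂ F (b c))).restrictScalars ℝ

/-- `entryCLM b a c L = [L]_{ac}`. [folklore] -/
@[simp]
theorem entryCLM_apply (b : Module.Basis (Fin r) ℂ F) (a c : Fin r) (L : F →L[ℂ] F) :
    entryCLM b a c L = LinearMap.toMatrix b b (L : F →ₗ[ℂ] F) a c := by
  simp [entryCLM, LinearMap.toMatrix_apply]

end Entry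

/-! ### Unitary connections as cocycle connections -/

namespace UnitaryConnection

variable {E : Type*} [NormedAddCommGroup E] [NormedSpace ℂ E]
  {M : Type*} [TopologicalSpace M] [ChartedSpace E M] [IsManifold 𝓘(ℝ, E) ∞ M]
  {F : Type*} [NormedAddCommGroup F] [InnerProductSpace ℂ F] [FiniteDimensional ℂ F]
  {V : M → Type*} [TopologicalSpace (TotalSpace F V)] [∀ x, TopologicalSpace (V x)]
  [∀ x, AddCommGroup (V x)] [∀ x, Module ℂ (V x)] [FiberBundle F V] [VectorBundle ℂ F V]
  {h : HermitianStructure V} {r : ℕ}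

omit [IsManifold 𝓘(ℝ, E) ∞ M] [FiniteDimensional ℂ F] in
/-- On the overlaps, the transition operators are smooth at the point (from `IsSmoothCocycle`).
[folklore] -/
theorem contMDiffAt_atlasTransition (hV : IsSmoothCocycle E F V) {x₀ x₁ x : M}
    (h₀ : x ∈ (trivializationAt F V x₀).baseSet) (h₁ : x ∈ (trivializationAt F V x₁).baseSet) :
    ContMDiffAt 𝓘(ℝ, E) 𝓘(ℝ, F →L[ℂ] F) ∞ (atlasTransition (F := F) V x₀ x₁) x :=
  (hV x₁ x₀).contMDiffAt
    (((trivializationAt F V x₁).open_baseSet.inter (trivializationAt F V x₀).open_baseSet).mem_nhds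
      ⟨h₁, h₀⟩)

/-- **A smooth unitary connection, read in a basis `b` of the model fibre, is a connection on the
transition cocycle** `SmoothComplexVectorBundle.ofVectorBundle F V b hV`: connection matrices
`ω_{x₀} = [θ_{x₀}]_b` (entrywise `entryCLM b a c ∘ θ_{x₀}`), smooth on `U_{x₀}` as `θ_{x₀}` is, and the
gauge law (1.16) of the cocycle, `ω_j = g_{ji} ω_i g_{ij} + g_{ji} dg_{ij}` with
`g_{x₀x₁} = [atlasTransition V x₁ x₀]_b`, is the matrix form of the carrier's
`θ_{x₀} = a_{x₁x₀} ∘ (da_{x₀x₁} + θ_{x₁} ∘ a_{x₀x₁})` (`[A ∘ B] = [A][B]`, `[dA] = d[A]`). The unitarity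
of `D` is not used. [cite: Kobayashi1987, Ch. I §1 (1.16)] -/
def toCocycleConnection (b : Module.Basis (Fin r) ℂ F) (hV : IsSmoothCocycle E F V)
    (D : UnitaryConnection E F h) : (SmoothComplexVectorBundle.ofVectorBundle F V b hV).Connection where
  form x₀ := Matrix.of fun a c ↦ (D.form x₀).postcomp (entryCLM b a c)
  isSmoothFormOn_form x₀ a c := (D.isSmoothFormOn_form x₀).postcomp _
  form_eq p q x hx a c := by
    -- `x ∈ U_p ∩ U_q`; the carrier's law with `x₀ = q`, `x₁ = p`:
    -- `θ_q(v) = A ∘ (dB(v) + θ_p(v) ∘ B)`, `A = a_{pq}(x) = g_{qp}(x)`, `B = a_{qp}(x) = g_{pq}(x)`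
    ext v
    set A : F →L[ℂ] F := atlasTransition V p q x with hA
    set B : F →L[ℂ] F := atlasTransition V q p x with hB
    set dBv : F →L[ℂ] F := mextDeriv (MForm.ofFun 𝓘(ℝ, E) (atlasTransition (F := F) V q p)) x v
      with hdBv
    set θv : F →L[ℂ] F := D.form p x v with hθv
    have hlaw : D.form q x v = A.comp (dBv + θv.comp B) := D.form_eq q p x ⟨hx.2, hx.1⟩ v
    -- the four matrices
    set MA : Matrix (Fin r) (Fin r) ℂ := LinearMap.toMatrix b b (A : F →ₗ[ℂ] F) with hMA
    set MB : Matrix (Fin r) (Fin r) ℂ := LinearMap.toMatrix b b (B : F →ₗ[ℂ] F) with hMB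
    set MdB : Matrix (Fin r) (Fin r) ℂ := LinearMap.toMatrix b b (dBv : F →ₗ[ℂ] F) with hMdB
    set Mθ : Matrix (Fin r) (Fin r) ℂ := LinearMap.toMatrix b b (θv : F →ₗ[ℂ] F) with hMθ
    -- `d` commutes with taking a matrix entry: `d[B]_{dc'} = [dB]_{dc'}`
    have hsm : ∀ d c' : Fin r, mextDeriv (MForm.ofFun 𝓘(ℝ, E) fun y ↦
        LinearMap.toMatrix b b (atlasCoordChange F V p q y : F →ₗ[ℂ] F) d c') x v = MdB d c' :=
      fun d c' ↦ by
      have h1 := mextDeriv_ofFun_clm_apply (contMDiffAt_atlasTransition hV hx.2 hx.1)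
        (entryCLM b d c') v
      simp only [entryCLM_apply] at h1
      exact h1
    -- left-hand side: the `(a, c)` entry of `[A]([dB] + [θ][B])`
    have hc1 : ((A.comp (dBv + θv.comp B) : F →L[ℂ] F) : F →ₗ[ℂ] F) =
        (A : F →ₗ[ℂ] F).comp ((dBv : F →ₗ[ℂ] F) + (θv : F →ₗ[ℂ] F).comp (B : F →ₗ[ℂ] F)) := rfl
    have lhs : (Matrix.of fun a c ↦ (D.form q).postcomp (entryCLM b a c)) a c x v =
        (MA * (MdB + Mθ * MB)) a c := by
      rw [Matrix.of_apply, MForm.postcomp_apply, entryCLM_apply, hlaw, hc1, LinearMap.toMatrix_comp b b b,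
        map_add, LinearMap.toMatrix_comp b b b]
    -- right-hand side, first term: the `(a, c)` entry of `[A][θ][B]`
    have rhs₁ : ((MatrixForm.mulLeft ((SmoothComplexVectorBundle.ofVectorBundle F V b hV).coordChange q p)
        (Matrix.of fun a c ↦ (D.form p).postcomp (entryCLM b a c))).mulRight
          ((SmoothComplexVectorBundle.ofVectorBundle F V b hV).coordChange p q)) a c x v =
        (MA * Mθ * MB) a c := by
      simp only [MatrixForm.mulRight_apply, MatrixForm.mulLeft_apply, Matrix.of_apply,
        ContinuousAlternatingMap.sum_apply, ContinuousAlternatingMap.smul_apply, MForm.postcomp_apply,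
        entryCLM_apply, SmoothComplexVectorBundle.ofVectorBundle_coordChange, Matrix.mul_apply,
        smul_eq_mul, Finset.sum_mul, Finset.mul_sum]
      refine Finset.sum_congr rfl fun e _ ↦ Finset.sum_congr rfl fun d _ ↦ ?_
      change LinearMap.toMatrix b b (B : F →ₗ[ℂ] F) e c * (MA a d * Mθ d e) = MA a d * Mθ d e * MB e c
      ring
    -- right-hand side, second term: the `(a, c)` entry of `[A][dB]`
    have rhs₂ : (MatrixForm.mulLeft ((SmoothComplexVectorBundle.ofVectorBundle F V b hV).coordChange q p)
        (MatrixForm.ofFun (I := 𝓘(ℝ, E))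
          ((SmoothComplexVectorBundle.ofVectorBundle F V b hV).coordChange p q)).d) a c x v =
        (MA * MdB) a c := by
      simp only [MatrixForm.mulLeft_apply, MatrixForm.d_apply, MatrixForm.ofFun_apply,
        ContinuousAlternatingMap.sum_apply, ContinuousAlternatingMap.smul_apply,
        SmoothComplexVectorBundle.ofVectorBundle_coordChange, hsm, Matrix.mul_apply, smul_eq_mul]
      rfl
    rw [lhs, ContinuousAlternatingMap.add_apply, rhs₁, rhs₂, Matrix.mul_add, Matrix.add_apply,
      Matrix.mul_assoc, add_comm]

end UnitaryConnection

end Literature.Geometry.Kaehler
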